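import Literature.MathematicalPhysics.QuantumFieldTheory.LeeSmirnov2011.ThreeLoopMastersAnalytic
import HarnessLib

/-!
# Schröder–Vuorinen 2005 / Broadhurst 1992–1998: the single-mass three-loop vacuum (tadpole) integrals — the «QED-type»
# classification, the printed reduction formulas exact in `d`, the printed analytic four-massive-line banana, and kernel
# cross-checks against the Lee–Smirnov 2011 tables and Broadhurst's constant `B₄`

CITATION HEADER (venture `QEDPrecision`, cell `qed-ibp`, seat `qed-ibp-lit`; typed PUBLISHED statements only — this file
asserts no physics and proves only exact arithmetic between printed forms).

* Y. Schröder, A. Vuorinen, *High-precision epsilon expansions of single-mass-scale four-loop vacuum bubbles*, JHEP 06 (2005)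
  051, arXiv:hep-ph/0503209 [SchroderVuorinen2005] (held text `paper:arxiv-hep-ph_0503209`; arXiv TeX `deqs4d.tex`, cell copy
  `qed-ibp-lit/sources/hep-ph_0503209/`, line numbers `l.N` below refer to it).
* D. J. Broadhurst, *Massive 3-loop Feynman diagrams reducible to SC* primitives of algebras of the sixth root of unity*, Eur.
  Phys. J. C8 (1999) 311, arXiv:hep-th/9803091 [Broadhurst1998] (held text `paper:arxiv-hep-th_9803091`), whose §2 restates
* D. J. Broadhurst, *Three-loop on-shell charge renormalization without integration: Λ_QED to four loops*, Z. Phys. C54 (1992)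
  599 [Broadhurst1992] (= «[wp2]» of [Broadhurst1998]; not held as text — every statement attributed to it below is quoted from
  [Broadhurst1998] §2 or [SchroderVuorinen2005] §6.3).

NORMALISATION. [Broadhurst1998] eq. (vdef): `V(r₁…r₆) = ∫[dp][dk][dl] P₁(k)P₂(p+k)P₃(k−l)P₄(l)P₅(p+l)P₆(p)`, `P_j(p) = 1/(p²+m²r_j)`,
`[dl] = d^Dl/(m^{D−4}π^{D/2}Γ(1+ε))`, `D = 4−2ε` — i.e. exactly the bracket `I/C(ω)` of [LaportaRemiddi1996] and `G/Γ(1+ε)³` of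
[LeeSmirnov2011] (Euclidean, `m = 1`). [SchroderVuorinen2005] use `∫_p = Γ(2+ε)⁻¹∫d^{4−2ε}p/π^{2−ε}` (l.693–696), so their 1-loop
tadpole is `J = −1/(ε(1−ε²))`; all their analytic statements used here are RATIOS `X/J³` (measure-free, §6 «we normalize every
integral with the appropriate power of the 1-loop tadpole») or reduction formulas homogeneous of degree three in the loop
measure, hence valid verbatim in the normalisation above, where the tadpole cubed is `Γ(ε−1)³/Γ(1+ε)³ = (1/((ε−1)ε))³` = the
bracket `g3` of [LeeSmirnov2011]'s `G₃` (`ThreeLoopMastersAnalytic.lean`).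

WHAT IS TYPED (data, as printed):
* `Colouring`, `threeLoopColourings`, `isQEDType` — the three 3-loop vacuum topologies (4-line banana, 5-line «VV», 6-line
  tetrahedron) with the vertex–line incidences of the paper's pictograms (axodraw macros `ToprVB/ToprVV/ToprVM`, l.91–101) and
  its 25 colourings by mass (l.172–198), and the paper's class «QED-type» := «an even number of massive lines at each vertex»
  (abstract, p0002 L6–8).
* `svThreeBOverJ3` — §6.3 l.1390–1404: the four-massive-line banana `threeB/J³` («B_N(0,0,1,1,1,1) in the literature»)
  analytically through `ε⁶`, «deduced from the function B₄ introduced in [Broadhurst:1991fi]» (= [Broadhurst1992]) «… two more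
  orders … from B₄ as given in [Broadhurst:1996az]».
* `RedTerm`, `redVc … redMb` — §6.3 l.1425–1435 and l.1483–1496: the reduction formulas, exact in `d`, of the reducible QED-type
  colourings onto {`threeB` (= LS `G_{4,5}` = LR `I₁₃`), `threeBa` (2 massive + 2 massless banana = LS `G_{4,4}` = LR `I₁₄`),
  `J³` (= LS `G₃` = LR `I₁₈`)}; the identification of `threeB`, `threeBa` with `G_{4,5}`, `G_{4,4}` is by coincidence of printed
  expansions (`sv_threeB_matches_LS` below; for `threeBa` S-V print the Γ-closed form l.1360, whose expansion the cell checked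
  against `G_{4,4}` outside Lean — Γ-functions are not kernel data).
* `broadhurstB4`, `broadhurstVC` — [Broadhurst1998] §2: `B₄ := ½(V_{4N} − V_{3T}) = 16 Li₄(½) + ⅔ln⁴2 − ⅔π²ln²2 − 13π⁴/180 + O(ε)`
  (eq. (B4), «for the finite combination that enters …», = [Broadhurst1992]) and `V_j = (1/(3ε)+1)·6ζ(3) + 3ζ(4) − F_j + O(ε)`
  (eq. (VC)) with `F_{3T} = 12ζ(4)` (eq. after (f3T)); `V_{4N}` = S-V's colouring `threeMb` (massive 4-cycle, the two massless
  lines non-adjacent: «the QED case with 4 massive (electron) lines and two massless (photon) lines that are not adjacent»),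
  `V_{3T}` = `threeMd` («three masses forming a triangle»).

WHAT IS PROVED (kernel arithmetic, `decide +kernel`):
* `qedType_threeLoop` — exactly seven 3-loop colourings are QED-type: `threeB, threeBa, threeVc, threeVf, threeVh, threeMb,
  threeMd`; with S-V's master/reducible status (l.1330–1496) the QED-type MASTERS are `threeB`, `threeBa` (and `J³`).
* `sv_threeB_matches_LS` — S-V's printed `threeB/J³` (orders 0…6) times `J³` equals [LeeSmirnov2011]'s printed `G_{4,5}` at
  every order `ε⁻³…ε³`: a third printed source for LR's `I₁₃` through the order carrying `a₅, ln⁵2, π⁴ln 2`.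
* `sv_Md_gives_broadhurst_V3T` — S-V's reduction (Md) evaluated on the LS tables gives `V_{3T} = 2ζ₃/ε + (6ζ₃ + 3ζ₄ − 12ζ₄) + O(ε)`,
  i.e. [Broadhurst1998] eq. (VC) with the printed `F_{3T}`.
* `sv_Mb_minus_Md_gives_broadhurst_B4` — ½[(Mb) − (Md)] on the LS tables has no poles and finite part = `B₄` as printed:
  Schröder–Vuorinen's reductions × Lee–Smirnov's analytics reproduce Broadhurst 1992's constant exactly.
* `sv_Mb_leading` — (Mb) on the LS tables: `V_{4N} = 2ζ₃/ε + …` (the universal `2ζ(3)/ε` of eq. (VC)), poles `ε⁻³, ε⁻²` absent.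
Deliberately NOT here: values of integrals as reals; the Γ-closed forms (l.1358–1362) and `₃F₂` forms; S-V's 50-digit numerics;
MATAD's constants. 0 unproved facts.
-/

namespace Literature.MathematicalPhysics.QuantumFieldTheory.SchroderVuorinen2005

open LeeSmirnov2011

/-! ### 1. Topologies, colourings by mass, and the class «QED-type» -/

/-- The three 3-loop vacuum topologies of [SchroderVuorinen2005] §6.3 («There are three 3-loop topologies»): the 4-line
banana (pictogram `ToprVB`, 2 vertices), the 5-line topology (pictogram `ToprVV`: two 2-line bubbles {1,4} and {2,5} sharing the
bottom vertex, joined on top by line 3; 3 vertices) and the 6-line tetrahedron (pictogram `ToprVM`: rim arcs 1,2,3, spokes 4,5,6;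
4 vertices). [cite: SchroderVuorinen2005, §6.3 and TeX l.91-101] -/
inductive Topo where
  | banana | vv | tetra
deriving DecidableEq, Repr

/-- Vertex–line incidence of each pictogram (line numbers = macro argument positions, l.91-101): banana: both vertices meet
lines 1–4; VV: top-left {1,3,4}, top-right {2,3,5}, bottom {1,2,4,5}; tetrahedron: top {1,3,6}, lower-left {1,2,5}, lower-right
{2,3,4}, centre {4,5,6}. [cite: SchroderVuorinen2005, TeX l.91-101 (macros ToprVB, ToprVV, ToprVM)] -/
def Topo.vertices : Topo → List (List ℕ)
  | .banana => [[1, 2, 3, 4], [1, 2, 3, 4]]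
  | .vv => [[1, 3, 4], [2, 3, 5], [1, 2, 4, 5]]
  | .tetra => [[1, 3, 6], [1, 2, 5], [2, 3, 4], [4, 5, 6]]

/-- A colouring by mass: the paper's macro name, its topology, and per line `true` = massive (solid, `\Asc/\Lsc`),
`false` = massless (dashed, `\Ahh/\Lhh`). [cite: SchroderVuorinen2005, TeX l.172-198] -/
structure Colouring where
  name : String
  topo : Topo
  massive : List Bool
deriving DecidableEq, Repr

/-- The 4 + 11 + 10 colourings of the three 3-loop topologies exactly as defined in the TeX source (l.172-198; argument order =
line number). [cite: SchroderVuorinen2005, TeX l.172-198; §6.3 «four colorings … eleven colorings … ten colorings»] -/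
def threeLoopColourings : List Colouring :=
  [⟨"threeB", .banana, [true, true, true, true]⟩, ⟨"threeBa", .banana, [false, false, true, true]⟩,
   ⟨"threeBb", .banana, [false, true, true, true]⟩, ⟨"threeBc", .banana, [false, false, true, false]⟩,
   ⟨"threeV", .vv, [true, true, true, true, true]⟩, ⟨"threeVa", .vv, [true, true, true, false, true]⟩,
   ⟨"threeVb", .vv, [false, true, true, false, true]⟩, ⟨"threeVc", .vv, [true, true, true, false, false]⟩,
   ⟨"threeVd", .vv, [true, false, true, false, false]⟩, ⟨"threeVe", .vv, [false, false, true, false, false]⟩,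
   ⟨"threeVf", .vv, [true, true, false, true, true]⟩, ⟨"threeVg", .vv, [true, true, false, true, false]⟩,
   ⟨"threeVh", .vv, [true, false, false, true, false]⟩, ⟨"threeVi", .vv, [true, true, false, false, false]⟩,
   ⟨"threeVj", .vv, [true, false, false, false, false]⟩,
   ⟨"threeM", .tetra, [true, true, true, true, true, true]⟩, ⟨"threeMa", .tetra, [true, true, true, true, true, false]⟩,
   ⟨"threeMb", .tetra, [true, false, true, true, true, false]⟩, ⟨"threeMc", .tetra, [true, false, false, true, true, true]⟩,
   ⟨"threeMd", .tetra, [true, true, true, false, false, false]⟩, ⟨"threeMe", .tetra, [true, false, true, true, false, false]⟩,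
   ⟨"threeMf", .tetra, [false, false, false, true, true, true]⟩, ⟨"threeMg", .tetra, [false, false, false, true, true, false]⟩,
   ⟨"threeMh", .tetra, [false, true, false, false, false, true]⟩, ⟨"threeMi", .tetra, [false, false, false, false, false, true]⟩]

/-- «`QED-type' vacuum integrals, i.e. those with an even number of massive lines at each vertex». [cite: SchroderVuorinen2005, abstract and §1 (p0002 L6-8, p0003 L64-66)] -/
def isQEDType (c : Colouring) : Bool :=
  c.topo.vertices.all fun v => (v.filter fun i => c.massive.getD (i - 1) false).length % 2 == 0

/-- Exactly seven of the 25 three-loop colourings are QED-type: the bananas `threeB` (4 massive) and `threeBa` (2+2), the VV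
colourings `threeVc` (bubbles (m,0),(m,0), massive connector), `threeVf` (bubbles (m,m),(m,m), massless connector), `threeVh`,
and the tetrahedra `threeMb` (massive 4-cycle, non-adjacent massless pair = [Broadhurst1998]'s `V_{4N}`) and `threeMd` (massive
triangle = `V_{3T}`). By §6.3 (l.1330-1496) `threeB`, `threeBa` are masters and the other five reduce (`redVc … redMb` below).
[cite: SchroderVuorinen2005, §6.3; Broadhurst1998, §1 Fig. 2 and §2] -/
theorem qedType_threeLoop :
    (threeLoopColourings.filter isQEDType).map (·.name)
      = ["threeB", "threeBa", "threeVc", "threeVf", "threeVh", "threeMb", "threeMd"] := by decide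

/-! ### 2. Series arithmetic on printed coefficients (extends `LeeSmirnov2011.SCoeff/ESeries`) -/

/-- Product of two monomials in the printed constants. [cite: LeeSmirnov2011, §3 (the constants)] -/
def monoMul (a b : Mono) : Mono :=
  { pi := a.pi + b.pi, z3 := a.z3 + b.z3, z5 := a.z5 + b.z5, z7 := a.z7 + b.z7, ln2 := a.ln2 + b.ln2, a4 := a.a4 + b.a4,
    a5 := a.a5 + b.a5, a6 := a.a6 + b.a6, a7 := a.a7 + b.a7, s6 := a.s6 + b.s6, s7a := a.s7a + b.s7a, s7b := a.s7b + b.s7b }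

/-- Product of two printed coefficients (term by term). [cite: SchroderVuorinen2005, §6.3] -/
def scMul (a b : SCoeff) : SCoeff :=
  a.foldr (fun s acc => (b.map fun t => (s.1 * t.1, monoMul s.2 t.2)) ++ acc) []

/-- Total coefficient of the monomial `m` in a printed coefficient. [cite: SchroderVuorinen2005, §6.3] -/
def scCoeffOf (c : SCoeff) (m : Mono) : ℚ := ((c.filter fun t => t.2 = m).map (·.1)).sum

/-- Two printed coefficients denote the same ℚ-combination of monomials. [cite: SchroderVuorinen2005, §6.3] -/
def scEquiv (a b : SCoeff) : Bool := (a ++ b).all fun t => scCoeffOf a t.2 == scCoeffOf b t.2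

/-- Option-lifted `scEquiv` (`none` on either side — an order beyond print — never matches). [cite: SchroderVuorinen2005, §6.3] -/
def coeffAgree : Option SCoeff → Option SCoeff → Bool
  | some a, some b => scEquiv a b
  | _, _ => false

/-- `ε^k` coefficient of the product of two printed truncated series (`none` if an order beyond print is needed).
[cite: SchroderVuorinen2005, §6.3] -/
def esMulCoeff? (A B : ESeries) (k : ℤ) : Option SCoeff :=
  if k < A.lo + B.lo then some [] else
  (List.range (k - A.lo - B.lo).toNat.succ).foldr (fun (j : ℕ) acc =>
    match A.coeff? (A.lo + j), B.coeff? (k - A.lo - j), acc with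
    | some a, some b, some s => some (scMul a b ++ s)
    | _, _, _ => none) (some [])

/-- [LeeSmirnov2011]'s `G/Γ(1+ε)³` (printed bracket × printed prefactor, `lsExpanded?`) materialised as a truncated series of `n`
orders from the leading one; `n` is chosen within print for each use below (`lsWithin` certifies it). [cite: LeeSmirnov2011, §3] -/
def lsSeries (g : ℕ × ℕ) (n : ℕ) : ESeries :=
  ⟨(lsBracket g).lo, (List.range n).map fun j => (lsExpanded? g ((lsBracket g).lo + j)).getD []⟩

/-- The three QED-type tadpole masters in the LS tables: `I₁₃ = G_{4,5}/Γ³` (9 printed orders `ε⁻³…ε⁵`), `I₁₄ = G_{4,4}/Γ³`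
(8 orders `ε⁻³…ε⁴`), `I₁₈ = G₃/Γ³ = J³` (12 orders `ε⁻³…ε⁸`). [cite: LeeSmirnov2011, §3 displays for G₃, G_{4,4}, G_{4,5}] -/
def i13 : ESeries := lsSeries (4, 5) 9
/-- See `i13`. [cite: LeeSmirnov2011, §3 display for G_{4,4}] -/
def i14 : ESeries := lsSeries (4, 4) 8
/-- See `i13`. [cite: LeeSmirnov2011, §3 first display (G₃)] -/
def i18 : ESeries := lsSeries (3, 0) 12

/-- Hygiene: every order materialised in `i13`, `i14`, `i18` is within Lee–Smirnov's print (no silent zero).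
[cite: LeeSmirnov2011, §3] -/
theorem lsWithin :
    ((List.range 9).all fun j => (lsExpanded? (4, 5) (-3 + j)).isSome)
    ∧ ((List.range 8).all fun j => (lsExpanded? (4, 4) (-3 + j)).isSome)
    ∧ ((List.range 12).all fun j => (lsExpanded? (3, 0) (-3 + j)).isSome) := by decide +kernel

/-! ### 3. The printed analytic four-massive-line banana -/

/-- [SchroderVuorinen2005] §6.3, l.1390-1404, AS PRINTED: `threeB/J³ = −2 − 5/3ε − 1/2ε² + 103/12ε³ + 7/24(163−128ζ₃)ε⁴
+ (9055/48 + 136π⁴/45 + 32/3 ln²2(π²−ln²2) − 168ζ₃ − 256a₄)ε⁵ + (63517/96 + 16/5 ln⁴2(4ln2−15) − 16/3π²ln²2(4ln2−9)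
− 68/15π⁴(4ln2−3) − 1876/3ζ₃ + 1240ζ₅ − 1152a₄ − 1536a₅)ε⁶ + O(ε⁷)` (products expanded term by term here).
[cite: SchroderVuorinen2005, §6.3 (3-loop, 4 lines), TeX l.1390-1404] -/
def svThreeBOverJ3 : ESeries :=
  ⟨0, [[((-2), {})],
       [((-5/3), {})],
       [((-1/2), {})],
       [(103/12, {})],
       [(7 * 163 / 24, {}), ((-(7 * 128 / 24)), { z3 := 1 })],
       [(9055/48, {}), (136/45, { pi := 4 }), (32/3, { pi := 2, ln2 := 2 }), ((-32/3), { ln2 := 4 }), ((-168), { z3 := 1 }),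
        ((-256), { a4 := 1 })],
       [(63517/96, {}), (64/5, { ln2 := 5 }), ((-48), { ln2 := 4 }), ((-64/3), { pi := 2, ln2 := 3 }), (48, { pi := 2, ln2 := 2 }),
        ((-272/15), { pi := 4, ln2 := 1 }), (68/5, { pi := 4 }), ((-1876/3), { z3 := 1 }), (1240, { z5 := 1 }), ((-1152), { a4 := 1 }),
        ((-1536), { a5 := 1 })]]⟩

/-- THREE PRINTED SOURCES FOR `I₁₃`: Schröder–Vuorinen's analytic `threeB/J³` (orders 0…6) multiplied by `J³ = G₃/Γ³` equals
Lee–Smirnov's printed `G_{4,5}/Γ³` at every order `ε⁻³…ε³` (the orders LR1996 print, `ε⁻³…ε²`, were matched to LS in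
`ls_matches_LR1996`). [cite: SchroderVuorinen2005, §6.3 l.1390-1404; LeeSmirnov2011, §3 display for G_{4,5}] -/
theorem sv_threeB_matches_LS :
    ((List.range 7).all fun j => coeffAgree (esMulCoeff? svThreeBOverJ3 i18 (-3 + j)) (i13.coeff? (-3 + j))) = true := by
  decide +kernel

/-! ### 4. The printed reduction formulas (exact in `d = 4 − 2ε`) and Broadhurst's constants -/

/-- The three masters the QED-type reductions land on. [cite: SchroderVuorinen2005, §6.3] -/
inductive Master where
  | B | Ba | J3
deriving DecidableEq, Repr

/-- The LS series of a master (`threeB ↦ i13`, `threeBa ↦ i14`, `J³ ↦ i18`). [cite: SchroderVuorinen2005, §6.3; LeeSmirnov2011, §3] -/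
def Master.series : Master → ESeries
  | .B => i13
  | .Ba => i14
  | .J3 => i18

/-- One term `c · ε^s · Π(a d + b) / Π(a' d + b') · master` of a printed reduction formula, with `d = 4 − 2ε`; the linear factors
are stored as `(a, b)`; factors `(d−4)` of printed DENOMINATORS are taken out as `ε^s` with `1/(d−4) = −1/(2ε)` absorbed in `c`.
[cite: SchroderVuorinen2005, §6.3 l.1425-1435, l.1483-1496] -/
structure RedTerm where
  c : ℚ
  s : ℤ := 0
  num : List (ℚ × ℚ) := []
  den : List (ℚ × ℚ) := []
  m : Master
deriving DecidableEq, Repr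

/-- `a d + b` at `d = 4 − 2ε` as the linear ε-factor `(4a + b) + (−2a)ε`. [cite: SchroderVuorinen2005, §4 («ε = (4−d)/2»)] -/
def linD (f : ℚ × ℚ) : ℚ × ℚ := (4 * f.1 + f.2, -2 * f.1)

/-- `ε^k` coefficient of one reduction term (prefactor expanded to 14 orders via `LeeSmirnov2011.prefactorSeries`).
[cite: SchroderVuorinen2005, §6.3] -/
def RedTerm.coeff? (t : RedTerm) (k : ℤ) : Option SCoeff :=
  (mulCoeff? (prefactorSeries 14 (t.num.map linD, t.den.map linD)) t.m.series (k - t.s)).map (SCoeff.smul t.c)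

/-- `ε^k` coefficient of a printed reduction formula = sum of its terms. [cite: SchroderVuorinen2005, §6.3] -/
def redCoeff? (ts : List RedTerm) (k : ℤ) : Option SCoeff :=
  ts.foldr (fun t acc => match t.coeff? k, acc with
    | some a, some b => some (a ++ b)
    | _, _ => none) (some [])

/-- (l.1426) `threeVc = [ (3d−8)·threeBa + (d−2)²/(d−3)·J³ ] / (4(d−3))` — the QED colouring with bubbles (m,0),(m,0) and a
massive connector. [cite: SchroderVuorinen2005, §6.3 TeX l.1426-1427] -/
def redVc : List RedTerm :=
  [{ c := 1/4, num := [(3, -8)], den := [(1, -3)], m := .Ba },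
   { c := 1/4, num := [(1, -2), (1, -2)], den := [(1, -3), (1, -3)], m := .J3 }]

/-- (l.1429) `threeVf = −[ (3d−8)·threeB + 2(d−2)²/(d−3)·J³ ] / (4(d−4))` — bubbles (m,m),(m,m), massless connector;
`1/(d−4) = −1/(2ε)`. [cite: SchroderVuorinen2005, §6.3 TeX l.1429-1430] -/
def redVf : List RedTerm :=
  [{ c := 1/8, s := -1, num := [(3, -8)], m := .B },
   { c := 1/4, s := -1, num := [(1, -2), (1, -2)], den := [(1, -3)], m := .J3 }]

/-- (l.1433) `threeVh = −(3d−8)/(4(2d−7))·threeBa`. [cite: SchroderVuorinen2005, §6.3 TeX l.1433] -/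
def redVh : List RedTerm :=
  [{ c := -1/4, num := [(3, -8)], den := [(2, -7)], m := .Ba }]

/-- (eq. (Md), l.1491) `threeMd = −3(3d−10)(3d−8)/(16(d−4)(2d−7))·threeBa − (d−2)²/(8(d−4)(d−3))·J³` — the massive-triangle
tetrahedron, [Broadhurst1998]'s `V_{3T}`. [cite: SchroderVuorinen2005, §6.3 TeX l.1491-1492; Broadhurst1998, §2] -/
def redMd : List RedTerm :=
  [{ c := 3/32, s := -1, num := [(3, -10), (3, -8)], den := [(2, -7)], m := .Ba },
   { c := 1/16, s := -1, num := [(1, -2), (1, -2)], den := [(1, -3)], m := .J3 }]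

/-- (eq. (Mb), l.1487) `threeMb = (3d−10)(3d−8)/(16(d−4)²)·[threeB + 4(d−4)/(2d−7)·threeBa] + (d−2)²(5d−18)/(8(d−4)²(d−3))·J³`
— the tetrahedron with a massive 4-cycle and non-adjacent massless pair, [Broadhurst1998]'s `V_{4N}` («the QED case»);
`1/(d−4)² = 1/(4ε²)`. [cite: SchroderVuorinen2005, §6.3 TeX l.1487-1490; Broadhurst1998, §2] -/
def redMb : List RedTerm :=
  [{ c := 1/64, s := -2, num := [(3, -10), (3, -8)], m := .B },
   { c := -1/8, s := -1, num := [(3, -10), (3, -8)], den := [(2, -7)], m := .Ba },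
   { c := 1/32, s := -2, num := [(1, -2), (1, -2), (5, -18)], den := [(1, -3)], m := .J3 }]

/-- [Broadhurst1998] eq. (B4) (= [Broadhurst1992]): `B₄ := ½(V_{4N} − V_{3T}) = 16 Li₄(½) + ⅔ log⁴2 − ⅔ π² log²2 − 13π⁴/180 + O(ε)`
«for the finite combination that enters the 3-loop QCD radiative corrections to the electroweak rho-parameter».
[cite: Broadhurst1998, §2 eq. (B4) (p0003 L92-93)] -/
def broadhurstB4 : SCoeff :=
  [(16, { a4 := 1 }), (2/3, { ln2 := 4 }), ((-2/3), { pi := 2, ln2 := 2 }), ((-13/180), { pi := 4 })]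

/-- [Broadhurst1998] eq. (VC): `V_j = (1/(3ε) + 1)·6ζ(3) + 3ζ(4) − F_j + O(ε)`, here with `ζ(4) = π⁴/90` and the `ε⁻¹`, `ε⁰`
coefficients separated: `(2ζ₃, 6ζ₃ + π⁴/30 − F_j)`. [cite: Broadhurst1998, §2 eq. (VC) (p0002 L66-68)] -/
def broadhurstVC (F : SCoeff) : SCoeff × SCoeff :=
  ([(2, { z3 := 1 })], [(6, { z3 := 1 }), (1/30, { pi := 4 })] ++ SCoeff.smul (-1) F)

/-- [Broadhurst1998] eq. (f3T): `F_{3T} = 12ζ(4)` (= `2π⁴/15`). [cite: Broadhurst1998, §2 (p0003 L58)] -/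
def broadhurstF3T : SCoeff := [(12/90, { pi := 4 })]

/-- S-V's reduction (Md) on Lee–Smirnov's `G_{4,4}`, `G₃` gives Broadhurst's `V_{3T}` through the finite part: no `ε⁻³, ε⁻²`
poles, `ε⁻¹` coefficient `2ζ₃`, `ε⁰` coefficient `6ζ₃ + 3ζ₄ − F_{3T} = 6ζ₃ − π⁴/10`.
[cite: SchroderVuorinen2005, §6.3 eq. (Md); Broadhurst1998, §2 eqs. (VC), (f3T); LeeSmirnov2011, §3] -/
theorem sv_Md_gives_broadhurst_V3T :
    coeffAgree (redCoeff? redMd (-3)) (some []) ∧ coeffAgree (redCoeff? redMd (-2)) (some [])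
    ∧ coeffAgree (redCoeff? redMd (-1)) (some (broadhurstVC broadhurstF3T).1)
    ∧ coeffAgree (redCoeff? redMd 0) (some (broadhurstVC broadhurstF3T).2) := by decide +kernel

/-- S-V's reduction (Mb) on the LS tables: `V_{4N}` has no `ε⁻³, ε⁻²` poles (the `1/(d−4)²` is spurious) and its `ε⁻¹`
coefficient is the universal `2ζ₃` of [Broadhurst1998] eq. (VC). [cite: SchroderVuorinen2005, §6.3 eq. (Mb); Broadhurst1998, §2 eq. (VC); LeeSmirnov2011, §3] -/
theorem sv_Mb_leading :
    coeffAgree (redCoeff? redMb (-3)) (some []) ∧ coeffAgree (redCoeff? redMb (-2)) (some [])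
    ∧ coeffAgree (redCoeff? redMb (-1)) (some [(2, { z3 := 1 })]) := by decide +kernel

/-- BROADHURST 1992 FROM S-V × LS: `½[(Mb) − (Md)]` evaluated on Lee–Smirnov's printed `G_{4,5}, G_{4,4}, G₃` is pole-free and its
finite part is exactly `B₄ = 16a₄ + ⅔ln⁴2 − ⅔π²ln²2 − 13π⁴/180`.
[cite: Broadhurst1998, §2 eq. (B4); SchroderVuorinen2005, §6.3 eqs. (Mb), (Md); LeeSmirnov2011, §3] -/
theorem sv_Mb_minus_Md_gives_broadhurst_B4 :
    ((List.range 3).all fun j =>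
        coeffAgree ((redCoeff? (redMb ++ redMd.map fun t => { t with c := -t.c }) (-3 + j)).map (SCoeff.smul (1/2))) (some []))
    ∧ coeffAgree ((redCoeff? (redMb ++ redMd.map fun t => { t with c := -t.c }) 0).map (SCoeff.smul (1/2)))
        (some broadhurstB4) := by decide +kernel

end Literature.MathematicalPhysics.QuantumFieldTheory.SchroderVuorinen2005
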